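import Summits.ABC.ABC.Theses.PadicPrincipalCoreRadThree
import Summits.ABC.StewartYu.PadicLogFormsPrincipalReduction
import HarnessLib

/-!
# Route PadicPrincipalCoreRadThree, item `WPM`: closed by p1's principal-generators theorem

`Summits/ABC/ABC/Theorems/PadicPrincipalCoreRadThreeWPM.lean` — cell `abc-stewartyu`, seat p3 (the
mathematics is p1's WP-M: `Summit.ABC.StewartYu.PrincipalLattice.exists_principal_generators`,
`PadicLogFormsPrincipalReduction.lean`, whose statement is the item text verbatim).
-/

set_option linter.dupNamespace false

namespace Summit.ABC.ABC.Theorems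

/-- **Item `WPM` of route PadicPrincipalCoreRadThree** (principal generators: Minkowski II + Mahler +
Cramer, p1's WP-M). [folklore] -/
theorem padicPrincipalCoreRadThree_wpm_proof : Summit.ABC.ABC.Theses.PadicPrincipalCoreRadThree.WPM :=
  Summit.ABC.StewartYu.PrincipalLattice.exists_principal_generators

end Summit.ABC.ABC.Theorems
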